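import Literature.Analysis.FluidPDE.VorticityWeightedEnstrophyPersistence
import Literature.Analysis.FluidPDE.BiotSavartFarField
import HarnessLib

/-!
# Clay-class slices with zero hydrodynamic impulse: quartic velocity decay and integrability

Analysis/FluidPDE proof file (theorems only: no definitions, no named facts). The assembly of
three tree results into the statement the cell's `EpisodeBase` / `HeredityAtOne` negative lanes
ask for («zero impulse ⇒ `|x|⁻⁴` tails ⇒ slice ∈ `L¹`», refuter K147 R1 / K152 riders (i)–(iii)):

* `ClaySliceFarField.exists_forall_one_add_norm_pow_four_mul_norm_le_of_clayForce_of_impulse_eq_zero`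
  — for a classical finite-energy solution `(u, p)` of the forced Navier–Stokes system (`ν > 0`) on
  `[0, T] × ℝ³` with Schwartz datum (`HasRapidSpatialDecay (u 0)`) and Clay force
  (`IsSmoothOnHalfSpace f`, `HasRapidSpaceTimeDecay f`) there is ONE constant `K'` such that at
  every `t ∈ [0, T]` with `∫ y × curl u(t, y) dy = 0` (zero hydrodynamic impulse),
  `(1 + |x|)⁴ ‖u(t, x)‖ ≤ K'` for all `x`;
* `ClaySliceFarField.integrable_of_clayForce_of_impulse_eq_zero` — at such a time `u(t) ∈ L¹(ℝ³)`;
* `…_of_impulse_eq_zero'` — both, for the energy hypothesis in the `∃ C : ℝ≥0∞, C < ⊤ ∧ …` shape.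

Ingredients (all tree theorems): (1) the Biot–Savart representation `u(t) = BS[curl u(t)]` in the
`L²` class (`biotSavart_curl_eq_self_of_integrable_sq`, Majda–Bertozzi Prop. 2.16; `u(t) ∈ L²`
from the energy bound, `curl u(t) ∈ L²` from the `H^k` class); (2) the far-field bound
`BiotSavartFarField.exists_forall_one_add_norm_pow_four_mul_norm_biotSavart_le_of_impulse_eq_zero'`
(Saffman §3.2 / Majda–Bertozzi (2.92)–(2.95): for `C¹` divergence-free `ω` with moments, sup
bound `C₀`, quintic pointwise decay `C₅` and ZERO IMPULSE, `(1+|x|)⁴‖BS[ω](x)‖ ≤ K(C₀ + ‖ω‖₁ +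
∫|y|²‖ω‖ + C₅)`; the hypothesis `∫ ω = 0` is automatic for divergence-free integrable `ω`);
(3) persistence of the spatial decay of the VORTICITY (Lemarié-Rieusset Thm. 4.12 «no spreading
of the vorticity», tree `VorticityWeightedEnstrophyPersistence` §8–§9): uniformly on the slab,
`‖curl u(t)‖ ≤ C₀`, `|y|⁵‖curl u(t, y)‖ ≤ C₅`, `∫|y|^k‖curl u(t)‖ ≤ M_k`; and `div curl = 0`
(`divergence_curl_eq_zero_holds`). Then `(1+|x|)⁻⁴ ∈ L¹(ℝ³)` (`integrable_one_add_norm`).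

REMARK (why the impulse hypothesis cannot be dropped): for generic Schwartz data the velocity
spreads instantaneously to `u ~ |x|⁻⁴` only when the impulse vanishes; with nonzero impulse
`u(t, x) ~ |x|⁻³` (the dipole term), not integrable — Dobrokhotov–Shafarevich, Brandolese;
Lemarié-Rieusset §4.9 Thms. 4.10–4.11, Cor. 4.3.

Cell `ns-blowup` labels: LABEL Literature port (seat `ns-blowup-lit` g16); bears_on LADDER-NS N1
(route PalasekTowerBreakdown; crux 19179 line `slot` / crux 19249 negative lane: the slice of a
witness at a zero-impulse readout time is in `L¹` with `|x|⁻⁴` tails). WHAT THIS IS NOT: not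
Navier–Stokes evidence — a property of GIVEN classical solutions on a finite slab; no flow is
constructed and nothing about regularity or blow-up is asserted.

## References

* P. G. Lemarié-Rieusset, *The Navier–Stokes Problem in the 21st Century*, CRC Press (2016),
  §4.10 Thm. 4.12 (p. 93); §4.9 Thms. 4.10–4.11, Cor. 4.3. [LemarieRieusset2016]
* P. G. Saffman, *Vortex Dynamics*, CUP (1992), §3.2 (3.2.8)–(3.2.11), §3.5. [Saffman1992]
* A. J. Majda, A. L. Bertozzi, *Vorticity and Incompressible Flow*, CUP (2002), §2.4.1
  Prop. 2.16, (2.92)–(2.95). [MajdaBertozziCUP2002]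
-/

noncomputable section

open MeasureTheory Set Function Filter Metric
open scoped ENNReal NNReal ContDiff BigOperators Topology

namespace Literature.Analysis.FluidPDE

namespace ClaySliceFarField

/-! ## Zero impulse at a readout time ⇒ quartic velocity decay and an integrable slice -/

section FarField

variable {T ν : ℝ} {f u : ℝ → EuclideanSpace ℝ (Fin 3) → EuclideanSpace ℝ (Fin 3)}
  {p : ℝ → EuclideanSpace ℝ (Fin 3) → ℝ}

/-- **Clay-class data: the hypotheses of the Biot–Savart far-field bound hold on the whole slab,
with uniform constants.** For a classical finite-energy solution of the forced Navier–Stokes system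
(`ν > 0`) on `[0, T] × ℝ³` with Schwartz datum and Clay force there is ONE constant `K'` such that
at every time `t ∈ [0, T]` at which the hydrodynamic impulse vanishes, `∫ y × curl u(t, y) dy = 0`,
the velocity has quartic decay: `(1 + |x|)⁴ ‖u(t, x)‖ ≤ K'` for all `x`. Assembly:
`u(t) = BS[curl u(t)]` (`biotSavart_curl_eq_self_of_integrable_sq`, Majda–Bertozzi Prop. 2.16 in
the `L²` class: `u(t), curl u(t) ∈ L²` from the energy bound and the `H^k` class), the far-field
bound `BiotSavartFarField.exists_forall_one_add_norm_pow_four_mul_norm_biotSavart_le_of_impulse_eq_zero'`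
(Saffman §3.2 / Majda–Bertozzi (2.92)–(2.95): zero total vorticity and zero impulse kill the
`|x|⁻²` and `|x|⁻³` multipoles), and the persistence of vorticity decay of
`VorticityWeightedEnstrophyPersistence` §8–§9 (Lemarié-Rieusset Thm. 4.12) supplying, uniformly
in `t`, the sup bound `C₀`, the quintic pointwise decay `C₅` and the moments `∫‖ω‖`,
`∫|y|‖ω‖`, `∫|y|²‖ω‖` of `ω = curl u(t)`. [cite: LemarieRieusset2016, §4.10 Thm. 4.12 (p. 93)] [cite: Saffman1992, §3.2 (3.2.8)–(3.2.11); §3.5] [cite: MajdaBertozziCUP2002, §2.4.1 Prop. 2.16 (2.92)–(2.95)] -/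
theorem exists_forall_one_add_norm_pow_four_mul_norm_le_of_clayForce_of_impulse_eq_zero
    (h : IsClassicalNSSolutionOn (Icc 0 T) ν f u p) (hν : 0 < ν) (hT : 0 < T)
    (hE : ∃ C : ℝ≥0, ∀ t ∈ Icc 0 T, ∫⁻ x, ‖u t x‖ₑ ^ 2 ≤ C)
    (h₀ : HasRapidSpatialDecay (u 0)) (hfs : IsSmoothOnHalfSpace f) (hfd : HasRapidSpaceTimeDecay f) :
    ∃ K' : ℝ, ∀ t ∈ Icc 0 T, (∫ y, cross y (curl (u t) y)) = 0 →
      ∀ x, (1 + ‖x‖) ^ 4 * ‖u t x‖ ≤ K' := by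
  obtain ⟨K, hK0, hfar⟩ := exists_forall_one_add_norm_pow_four_mul_norm_biotSavart_le_of_impulse_eq_zero'
  obtain ⟨C₀, hC₀⟩ :=
    WeightedEnstrophy.exists_forall_norm_pow_mul_norm_curl_le_of_clayForce h hν hT hE h₀ hfs hfd 0
  obtain ⟨C₅, hC₅⟩ :=
    WeightedEnstrophy.exists_forall_norm_pow_mul_norm_curl_le_of_clayForce h hν hT hE h₀ hfs hfd 5
  obtain ⟨M₀, hM₀⟩ :=
    WeightedEnstrophy.exists_forall_integral_norm_pow_mul_norm_curl_le_of_clayForce h hν hT hE h₀ hfs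
      hfd 0
  obtain ⟨M₂, hM₂⟩ :=
    WeightedEnstrophy.exists_forall_integral_norm_pow_mul_norm_curl_le_of_clayForce h hν hT hE h₀ hfs
      hfd 2
  obtain ⟨X₀, hX₀⟩ :=
    WeightedEnstrophy.exists_integral_polyWeight_norm_curl_sq_le_of_clayForce h hν hT hE h₀ hfs hfd 0
  obtain ⟨Ce, hCe⟩ := hE
  refine ⟨K * (C₀ + M₀ + M₂ + C₅), fun t ht himp x => ?_⟩
  have hv := h.contDiff_velocity ht
  have hv2 : ContDiff ℝ 2 (u t) := hv.of_le (WithTop.coe_le_coe.2 le_top)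
  have hω1 : ContDiff ℝ 1 (curl (u t)) := contDiff_curl (n := 1) hv2
  have hωc : Continuous (curl (u t)) := hω1.continuous
  have hdivω : VectorCalculus.IsDivFree (curl (u t)) := fun y =>
    divergence_curl_eq_zero_holds (u t) hv2 y
  -- integrability of `ω`, `|y| ω`, `|y|² ω`
  have hi0 := WeightedEnstrophy.integrable_norm_pow_mul_norm_curl_of_clayForce h hν hT ⟨Ce, hCe⟩ h₀
    hfs hfd 0 ht
  have hi1 := WeightedEnstrophy.integrable_norm_pow_mul_norm_curl_of_clayForce h hν hT ⟨Ce, hCe⟩ h₀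
    hfs hfd 1 ht
  have hi2 := WeightedEnstrophy.integrable_norm_pow_mul_norm_curl_of_clayForce h hν hT ⟨Ce, hCe⟩ h₀
    hfs hfd 2 ht
  simp only [pow_zero, one_mul] at hi0
  simp only [pow_one] at hi1
  have hωi : Integrable (curl (u t)) := (integrable_norm_iff hωc.aestronglyMeasurable).1 hi0
  -- pointwise bounds
  have hC₀' : ∀ y, ‖curl (u t) y‖ ≤ C₀ := fun y => by simpa using hC₀ t ht y
  have hC₅' : ∀ y, ‖y‖ ^ 5 * ‖curl (u t) y‖ ≤ C₅ := hC₅ t ht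
  -- the Biot–Savart representation `u(t) = BS[curl u(t)]`
  have hu2 : Integrable fun y => ‖u t y‖ ^ 2 :=
    integrable_sq_norm_of_lintegral_lt_top hv.continuous ((hCe t ht).trans_lt ENNReal.coe_lt_top)
  have hω2 : Integrable fun y => ‖curl (u t) y‖ ^ 2 := by
    have h1 := (hX₀ t ht).1
    simpa only [pow_zero, one_mul] using h1
  have hrep : biotSavart (curl (u t)) = u t :=
    biotSavart_curl_eq_self_of_integrable_sq hv2 (h.divFree t ht) hu2 hω2
  -- the far-field bound
  have hmain := hfar hω1 hdivω hωi hi1 hi2 hC₀' hC₅' himp x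
  rw [hrep] at hmain
  have hM₀' : ∫ y, ‖curl (u t) y‖ ≤ M₀ := by simpa using hM₀ t ht
  have hM₂' : ∫ y, ‖y‖ ^ 2 * ‖curl (u t) y‖ ≤ M₂ := hM₂ t ht
  calc (1 + ‖x‖) ^ 4 * ‖u t x‖
      ≤ K * (C₀ + (∫ y, ‖curl (u t) y‖) + (∫ y, ‖y‖ ^ 2 * ‖curl (u t) y‖) + C₅) := hmain
    _ ≤ K * (C₀ + M₀ + M₂ + C₅) := by
        refine mul_le_mul_of_nonneg_left ?_ hK0.le
        linarith

/-- **Zero impulse at a readout time ⇒ the velocity slice is integrable.** Under the hypotheses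
of `exists_forall_one_add_norm_pow_four_mul_norm_le_of_clayForce_of_impulse_eq_zero`, at every
`t ∈ [0, T]` with `∫ y × curl u(t, y) dy = 0` the slice `u(t)` is in `L¹(ℝ³)`
(`(1 + |x|)⁻⁴ ∈ L¹(ℝ³)`). Without the zero-impulse condition this is generically FALSE
(Dobrokhotov–Shafarevich / Brandolese: `u ~ |x|⁻³` as soon as the impulse is nonzero,
Lemarié-Rieusset Thms. 4.10–4.11). [cite: LemarieRieusset2016, §4.10 Thm. 4.12 (p. 93); §4.9 Thms. 4.10–4.11] [cite: Saffman1992, §3.2 (3.2.8)–(3.2.11); §3.5] -/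
theorem integrable_of_clayForce_of_impulse_eq_zero
    (h : IsClassicalNSSolutionOn (Icc 0 T) ν f u p) (hν : 0 < ν) (hT : 0 < T)
    (hE : ∃ C : ℝ≥0, ∀ t ∈ Icc 0 T, ∫⁻ x, ‖u t x‖ₑ ^ 2 ≤ C)
    (h₀ : HasRapidSpatialDecay (u 0)) (hfs : IsSmoothOnHalfSpace f) (hfd : HasRapidSpaceTimeDecay f)
    {t : ℝ} (ht : t ∈ Icc 0 T) (himp : (∫ y, cross y (curl (u t) y)) = 0) :
    Integrable (u t) := by
  obtain ⟨K', hK'⟩ :=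
    exists_forall_one_add_norm_pow_four_mul_norm_le_of_clayForce_of_impulse_eq_zero h hν hT hE h₀ hfs hfd
  have hb := hK' t ht himp
  have hJ : Integrable fun x : EuclideanSpace ℝ (Fin 3) => (1 + ‖x‖) ^ (-(4 : ℝ)) :=
    integrable_one_add_norm (by rw [finrank_euclideanSpace_fin]; norm_num)
  refine Integrable.mono' (hJ.const_mul K') (h.contDiff_velocity ht).continuous.aestronglyMeasurable
    (Eventually.of_forall fun x => ?_)
  have ha : 0 < 1 + ‖x‖ := by positivity
  rw [Real.rpow_neg ha.le, show (4 : ℝ) = ((4 : ℕ) : ℝ) by norm_num, Real.rpow_natCast,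
    ← div_eq_mul_inv, le_div_iff₀ (by positivity), mul_comm]
  exact hb x

/-- The same two conclusions packaged for a consumer holding the energy bound in the
`∃ C : ℝ≥0∞, C < ⊤ ∧ …` form (the shape used by the cell's `EpisodeBase` slice-run files).
[cite: LemarieRieusset2016, §4.10 Thm. 4.12 (p. 93)] [cite: Saffman1992, §3.2 (3.2.8)–(3.2.11)] -/
theorem exists_forall_one_add_norm_pow_four_mul_norm_le_of_clayForce_of_impulse_eq_zero'
    (h : IsClassicalNSSolutionOn (Icc 0 T) ν f u p) (hν : 0 < ν) (hT : 0 < T)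
    (hE : ∃ C : ℝ≥0∞, C < ⊤ ∧ ∀ t ∈ Icc 0 T, ∫⁻ x, ‖u t x‖ₑ ^ 2 ≤ C)
    (h₀ : HasRapidSpatialDecay (u 0)) (hfs : IsSmoothOnHalfSpace f) (hfd : HasRapidSpaceTimeDecay f) :
    ∃ K' : ℝ, ∀ t ∈ Icc 0 T, (∫ y, cross y (curl (u t) y)) = 0 →
      Integrable (u t) ∧ ∀ x, (1 + ‖x‖) ^ 4 * ‖u t x‖ ≤ K' := by
  obtain ⟨C, hCt, hC⟩ := hE
  have hE' : ∃ C : ℝ≥0, ∀ t ∈ Icc 0 T, ∫⁻ x, ‖u t x‖ₑ ^ 2 ≤ C :=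
    ⟨C.toNNReal, fun t ht => (hC t ht).trans (ENNReal.coe_toNNReal hCt.ne).ge⟩
  obtain ⟨K', hK'⟩ :=
    exists_forall_one_add_norm_pow_four_mul_norm_le_of_clayForce_of_impulse_eq_zero h hν hT hE' h₀ hfs
      hfd
  exact ⟨K', fun t ht himp =>
    ⟨integrable_of_clayForce_of_impulse_eq_zero h hν hT hE' h₀ hfs hfd ht himp, hK' t ht himp⟩⟩

end FarField

end ClaySliceFarField

end Literature.Analysis.FluidPDE
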